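import Summits.HubbardSuperconductivity.HubbardSuperconductivity.Theorems.AnisotropyChordTransferFibre3RowCNhi
import Summits.HubbardSuperconductivity.HubbardSuperconductivity.Theorems.AnisotropyChordTransferFibre3N1RowCheckC

/-!
# Route `AnisotropyChord` / H0 rotor rung, row C (KT-2b) of the LEVEL-2 certificate: the `RExpr` PROGRAM of the row and its cell check

The KT-2b row on a `(ν, a)`-cell (all `L ≥ 128` at once) as ONE kernel inequality in the term language `RExpr`
(`Literature.Analysis.ValidatedNumerics.IntervalFunctions`) over p2's final cell vector (`…N1RowCheckC`:
`y₀ = t = θ²`, `y₁ = π²`, `y₂ = ν`, `y₃ = a`, `y₄ = ê₁ = ε₁/θ²`, `y₅…y₉ = B̂, P̂, Â, Q̂₁, Ĵ₁`) extended by three bracket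
coordinates `y₁₀ = x₄ = θ⁴S₂ ∈ c.bS2`, `y₁₁ = a_λ(1,1) ∈ k11I`, `y₁₂ = a_λ(2,0) ∈ k20I` (`ManifoldA.second_shell_window`):
* the `RExpr` mirrors `csE, MNE, …, ChiE xshi, NhiE, ZwE, tauE` of the normalised closed forms of `…RowCChi`/`…RowCNhi`
  (`ChiN`, `NhiN`) and of the crude window-shell majorant `ZwN` (this file; its analytic justification
  `Σ_{shellWin} C0(x̂,b)² ≤ ZwN` is `…RowCShellWin`), with their `eval` lemmas at a vector with `y₁ = π²`;
* `tauE = 3ν − (3/2)·Q̂₁/P̂` (`= T⁺/θ²`, cf. `trialGap_of_cellCheck`), and ★ the row inequality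
  `rowCE xshi bC = 9(√Chi + √Nhi)² − 48·π⁴·bC·(π²ν)·(2ê₁ − τ)·τ` (claim `≤ 0`);
* ★ `rowCCellCheck c a₁ a₂ xshi bC (prec, iters) : Bool` — p2's `cellFinalBoxC` extended by the three intervals, then
  `rexprLeOn` for `rowCE ≤ 0`, `−τ ≤ 0`, `τ − 2ê₁ ≤ 0`.
Soundness (`…RowCCellSound`): a passing check gives `OffPoleTailAbs`-pointwise with constant `bC` on the cell.
Prover seat `hubbard-h0-rotor-p1` g28 (route lead); helper for piece A = stmt-HubbardSuperconductivity-23918 of rung 19089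
(`--supports`, helper class).  WHAT THIS IS NOT: nothing here proves superconductivity in the Hubbard model; computable
definitions + eval lemmas of ONE row of ONE conditional reduction; the rotor TARGET as originally worded stays FALSE (g15
verdict).  Tree imports only; no sorry, no new axioms.
-/

set_option linter.dupNamespace false
set_option autoImplicit false

namespace Summit.HubbardSuperconductivity.HubbardSuperconductivity.Theorems.AnisotropyChord.Transfer.Fibre3

namespace RowC

variable (L : ℕ) [NeZero L]

open Literature.Analysis.ValidatedNumerics
open L2.N1

/-! ## The crude window-shell majorant `ZwN` (real) -/

/-- the uniform window gradient `g = 0.115·c_s`, the window sup `W₂ = a + 0.3644·c_s`, `ξ⁺ = 0.1145c_s`, `ζ⁺ = 0.0694c_s`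
and the per-configuration majorant `Cw = ½f g² + ½f(3g² + g f) + ½W₂(ξ⁺(g + f) + ζ⁺(3g + f))`, `f = f(x̂)`. -/
noncomputable def CwN (t ν a : ℝ) : ℝ :=
  let g := 0.115 * csN t ν a
  let W := a + 0.3644 * csN t ν a
  let f := fnnN ν a
  f / 2 * g ^ 2 + f / 2 * (3 * g ^ 2 + g * f) + W / 2 * (0.1145 * csN t ν a * (g + f) + 0.0694 * csN t ν a * (3 * g + f))

/-- `ZwN = 6·Cw²` (claim: `≥ Σ_{b ∈ shellWin} C0(x̂,b)²`, `…RowCShellWin`). -/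
noncomputable def ZwN (t ν a : ℝ) : ℝ := 6 * CwN t ν a ^ 2

/-! ## The `RExpr` mirrors -/

/-- `t`. -/
def yT : RExpr := .var 0
/-- `π²`. -/
def yPi2 : RExpr := .var 1
/-- `ν`. -/
def yNu : RExpr := .var 2
/-- `a`. -/
def yA : RExpr := .var 3
/-- `ê₁`. -/
def yE1 : RExpr := .var 4
/-- `P̂`. -/
def yP : RExpr := .var 6
/-- `Q̂₁`. -/
def yQ : RExpr := .var 8
/-- `x₄ = θ⁴S₂`. -/
def yX4 : RExpr := .var 10
/-- `a_λ(1,1)`. -/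
def yK11 : RExpr := .var 11
/-- `a_λ(2,0)`. -/
def yK20 : RExpr := .var 12

/-- `η = π²ν`. -/
def etaE : RExpr := .mul yPi2 yNu
/-- `4π²`. -/
def fourPi2 : RExpr := .mul (cst 4) yPi2
/-- `c_s = 4η(1 + at/4π²)`. -/
def csE : RExpr := .mul (.mul (cst 4) etaE) (.add (cst 1) (.mul (.mul yA yT) (.inv fourPi2)))
/-- `f(x̂) = a + η`. -/
def fnnE : RExpr := .add yA etaE
/-- `M`. -/
def MNE : RExpr := .add (.add (cst 1) (.mul (.mul yA yT) (.inv fourPi2))) (.mul csE (.add (cst 0.07) (.mul (cst 0.1) yNu)))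
/-- `t‖s‖²`. -/
def ts2E : RExpr := .mul (.add (.mul (.sq csE) yX4) (.mul (.sq yA) (.sq yT))) (.inv fourPi2)
/-- `σ`. -/
def sigE : RExpr := .add (.sub (cst 1) yA) (.mul (.mul yA yT) (.inv (.mul (cst 2) yPi2)))
/-- `tQ₀`. -/
def tQ0E : RExpr :=
  .add (.add fourPi2 (.mul (cst 3) yT)) (.mul (.add (.add (cst 6) (.mul (cst 4) sigE)) (.sq sigE)) (.sub ts2E (.mul yT (.sq (.sub (cst 1) yA)))))
/-- `τ̄`. -/
def tauNE : RExpr :=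
  .add (.mul (.mul (cst 2) etaE) (.sub (cst 1) yA))
    (.mul (.mul (.mul (cst 2) etaE) (.sub (.add yT ts2E) (.mul yT (.sq (.sub (cst 1) yA))))) (.inv fourPi2))
/-- `R̄`. -/
def RbE : RExpr := .sub tauNE (.mul (cst 2) (.sq etaE))
/-- `Γ`. -/
def GamE : RExpr := .mul (.mul (cst 2) (.sq MNE)) (.add RbE (.mul (cst 2) (.sq fnnE)))
/-- `X^hi` with the certified `xshi ≥ XSn`. -/
def XE (xshi : ℚ) : RExpr := .sub (.mul (.mul (.sq csE) (cst xshi)) (.inv (.mul (cst 8) yPi2))) (.mul (.mul (.sq etaE) yE1) yT)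
/-- ★ `Chi`. -/
def ChiE (xshi : ℚ) : RExpr :=
  .add (.add (.mul (.mul (.mul (cst 4) yE1) tQ0E) (XE xshi))
      (.mul (.mul (.mul yE1 yT) RbE) (.add GamE (.mul (.mul (cst 2) (.sq fnnE)) (.sq MNE)))))
    (.mul (.mul (cst 2) yE1) (.sqrt (.mul (.mul (.mul (.mul (.mul (cst 4) yT) tQ0E) (XE xshi)) GamE) RbE)))
/-- `a_λ(x̂)`. -/
def k10E : RExpr :=
  .mul (.add (.sub (cst 1) (.mul yT (.inv fourPi2)))
      (.mul (.mul (.add (.sub (cst 1) yA) (.mul (.mul yA yT) (.inv fourPi2))) yT) (.inv (.add fourPi2 (.mul yA yT)))))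
    (cst (1/4))
/-- `ξ`. -/
def xiE : RExpr := .mul csE (.sub yK20 k10E)
/-- `ζ`. -/
def zeE : RExpr := .mul csE (.sub yK11 k10E)
/-- `κ_w`. -/
def kapE : RExpr := .add (.add (.mul (cst 2) (.sq etaE)) (.sq xiE)) (.mul (cst 2) (.sq zeE))
/-- `crossW`. -/
def crE : RExpr := .add (.sub (.sq etaE) (.mul (.mul (cst 2) etaE) zeE)) (.mul (.mul (cst 2) xiE) zeE)
/-- `‖T₀s‖²`. -/
def lapE : RExpr :=
  .add (.add (.mul (.mul (.sq csE) (.sub (cst 1) (.mul yT (.inv fourPi2)))) (cst (1/4)))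
      (.mul (.mul (.mul csE (cst (1/2))) (.mul yNu yT)) (.add (.sub (cst 1) yA) (.mul (.mul yA yT) (.inv fourPi2)))))
    (.mul (.mul (.mul (.mul (.sq csE) (.sq yNu)) yX4) yT) (.inv (.mul (cst 16) yPi2)))
/-- `δ`. -/
def delE : RExpr := .add etaE (.mul (cst 0.001) csE)
/-- `Ψ⁺`. -/
def PsiE : RExpr :=
  .add (.mul (cst 8) (.sq (.sub tauNE kapE))) (.mul (cst 8) (.sq (.max crE (.sub (.mul lapE (cst (1/4))) crE))))
/-- bulk. -/
def bulkE : RExpr :=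
  .mul (.add (.add (.mul (.mul (cst 17) (.sq fnnE)) (.sq delE)) (.mul (.mul (cst 8) (.sq xiE)) (.sq MNE)))
    (.mul (.mul (cst 16) (.sq zeE)) (.sq MNE))) tauNE
/-- `Cw`. -/
def CwE : RExpr :=
  let g := .mul (cst 0.115) csE
  let W := .add yA (.mul (cst 0.3644) csE)
  .add (.add (.mul (.mul fnnE (cst (1/2))) (.sq g)) (.mul (.mul fnnE (cst (1/2))) (.add (.mul (cst 3) (.sq g)) (.mul g fnnE))))
    (.mul (.mul W (cst (1/2))) (.add (.mul (.mul (cst 0.1145) csE) (.add g fnnE)) (.mul (.mul (cst 0.0694) csE) (.add (.mul (cst 3) g) fnnE))))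
/-- `Zw = 6Cw²`. -/
def ZwE : RExpr := .mul (cst 6) (.sq CwE)
/-- ★ `Nhi`. -/
def NhiE : RExpr := .add (.mul (.mul (cst (9/4)) (.sq MNE)) PsiE) (.mul (cst 12) (.add ZwE bulkE))
/-- `τ = T⁺/θ² = 3ν − (3/2)·Q̂₁/P̂`. -/
def tauE : RExpr := .sub (.mul (cst 3) yNu) (.mul (.mul (cst (3/2)) yQ) (.inv yP))
/-- ★ THE ROW-C INEQUALITY `9(√Chi + √Nhi)² − 48π⁴·bC·η·(2ê₁ − τ)·τ` (claim: `≤ 0`). -/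
def rowCE (xshi bC : ℚ) : RExpr :=
  .sub (.mul (cst 9) (.sq (.add (.sqrt (ChiE xshi)) (.sqrt NhiE))))
    (.mul (.mul (.mul (.mul (.mul (cst 48) (.sq yPi2)) (cst bC)) etaE) (.sub (.mul (cst 2) yE1) tauE)) tauE)

/-! ## The cell check -/

/-- the rational enclosure of `a_λ(1,1) ∈ [1/π − 0.001, 1/π + 0.001]`. -/
def k11I : ℚ × ℚ := (3173 / 10000, 31931 / 100000)
/-- the rational enclosure of `a_λ(2,0) ∈ [1 − 2/π − 0.001, 1 − 2/π + 0.001]`. -/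
def k20I : ℚ × ℚ := (3623 / 10000, 3644 / 10000)

/-- the extended final box: p2's final box `F` plus the intervals of `x₄`, `a_λ(1,1)`, `a_λ(2,0)`. -/
def rowCBox (c : L2.NamedCell) (F : Box) : Box := F ++ [c.bS2, k11I, k20I]

/-- ★ THE ROW-C CELL CHECK on the `(ν, a)`-cell of `c, a₁, a₂` (all `L ≥ 128`): the extended final box exists with ten base
coordinates and `rowCE ≤ 0`, `P̂ ≥ 1`, `−τ ≤ 0`, `τ − 2ê₁ ≤ 0` hold on it. -/
def rowCCellCheck (c : L2.NamedCell) (a1 a2 xshi bC : ℚ) (pi : ℕ × ℕ) : Bool :=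
  match cellFinalBoxC c a1 a2 2 pi with
  | none => false
  | some F =>
    decide (F.length = 10) &&
    rexprLeOn (rowCE xshi bC) 0 (rowCBox c F) pi &&
    rexprLeOn (.neg yP) (-1) (rowCBox c F) pi &&
    rexprLeOn (.neg tauE) 0 (rowCBox c F) pi &&
    rexprLeOn (.sub tauE (.mul (cst 2) yE1)) 0 (rowCBox c F) pi

/-! ## Evaluation lemmas -/

section eval
variable (y : ℕ → ℝ) (hπ : y 1 = Real.pi ^ 2)
include hπ

/-- `etaE` evaluates to `etaN`. -/
theorem eval_etaE : etaE.eval y = etaN (y 2) := by simp [etaE, etaN, yPi2, yNu, RExpr.eval, hπ]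

/-- `csE` evaluates to `csN`. -/
theorem eval_csE : csE.eval y = csN (y 0) (y 2) (y 3) := by
  simp only [csE, csN, etaE, etaN, fourPi2, yPi2, yNu, yA, yT, cst, RExpr.eval, hπ]; push_cast; ring

/-- `fnnE` evaluates to `fnnN`. -/
theorem eval_fnnE : fnnE.eval y = fnnN (y 2) (y 3) := by
  simp [fnnE, fnnN, etaN, yPi2, yNu, yA, etaE, RExpr.eval, hπ]

/-- `MNE` evaluates to `MN`. -/
theorem eval_MNE : MNE.eval y = MN (y 0) (y 2) (y 3) := by
  simp [MNE, MN, csN, etaN, fourPi2, yPi2, yNu, yA, yT, cst, csE, etaE, RExpr.eval, hπ]; ring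

/-- `ts2E` evaluates to `ts2N`. -/
theorem eval_ts2E : ts2E.eval y = ts2N (y 0) (y 2) (y 3) (y 10) := by
  simp [ts2E, ts2N, csN, etaN, fourPi2, yPi2, yNu, yA, yT, yX4, cst, csE, etaE, RExpr.eval, hπ]; ring

/-- `tQ0E` evaluates to `tQ0N`. -/
theorem eval_tQ0E : tQ0E.eval y = tQ0N (y 0) (y 2) (y 3) (y 10) := by
  have h := eval_ts2E y hπ
  simp only [tQ0E, tQ0N, sigN, fourPi2, yPi2, yA, yT, cst, sigE, RExpr.eval] at *
  rw [h, hπ]; push_cast; ring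

/-- `tauNE` evaluates to `tauN`. -/
theorem eval_tauNE : tauNE.eval y = tauN (y 0) (y 2) (y 3) (y 10) := by
  have h := eval_ts2E y hπ
  have he := eval_etaE y hπ
  simp only [tauNE, tauN, fourPi2, yPi2, yA, yT, cst, RExpr.eval] at *
  rw [h, he, hπ]; push_cast; ring

/-- `RbE` evaluates to `RbN`. -/
theorem eval_RbE : RbE.eval y = RbN (y 0) (y 2) (y 3) (y 10) := by
  have h := eval_tauNE y hπ
  have he := eval_etaE y hπ
  simp only [RbE, RbN, cst, RExpr.eval] at *
  rw [h, he]; push_cast; ring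

/-- `GamE` evaluates to `GamN`. -/
theorem eval_GamE : GamE.eval y = GamN (y 0) (y 2) (y 3) (y 10) := by
  have h := eval_RbE y hπ
  have hm := eval_MNE y hπ
  have hf := eval_fnnE y hπ
  simp only [GamE, GamN, cst, RExpr.eval] at *
  rw [h, hm, hf]; push_cast; ring

/-- `XE` evaluates to `XN`. -/
theorem eval_XE (xshi : ℚ) : (XE xshi).eval y = XN (y 0) (y 2) (y 3) (y 4) xshi := by
  have hc := eval_csE y hπ
  have he := eval_etaE y hπ
  simp only [XE, XN, cst, yPi2, yE1, yT, RExpr.eval] at *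
  rw [hc, he, hπ]; push_cast; ring

/-- `ChiE` evaluates to `ChiN`. -/
theorem eval_ChiE (xshi : ℚ) : (ChiE xshi).eval y = ChiN (y 0) (y 2) (y 3) (y 4) (y 10) xshi := by
  have h1 := eval_tQ0E y hπ
  have h2 := eval_XE y hπ xshi
  have h3 := eval_RbE y hπ
  have h4 := eval_GamE y hπ
  have h5 := eval_fnnE y hπ
  have h6 := eval_MNE y hπ
  simp only [ChiE, ChiN, cst, yE1, yT, RExpr.eval] at *
  rw [h1, h2, h3, h4, h5, h6]; push_cast; ring_nf

/-- `k10E` evaluates to `k10N`. -/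
theorem eval_k10E : k10E.eval y = k10N (y 0) (y 3) := by
  simp [k10E, k10N, fourPi2, yPi2, yA, yT, cst, RExpr.eval, hπ]; ring

/-- `xiE`, `zeE` evaluate to `xiN`, `zeN`. -/
theorem eval_xiE_zeE : xiE.eval y = xiN (y 0) (y 2) (y 3) (y 12) ∧ zeE.eval y = zeN (y 0) (y 2) (y 3) (y 11) := by
  have hc := eval_csE y hπ
  have hk := eval_k10E y hπ
  simp only [xiE, zeE, xiN, zeN, yK20, yK11, RExpr.eval] at *
  rw [hc, hk]; exact ⟨rfl, rfl⟩

/-- `lapE` evaluates to `lapN`. -/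
theorem eval_lapE : lapE.eval y = lapN (y 0) (y 2) (y 3) (y 10) := by
  have hc := eval_csE y hπ
  simp only [lapE, lapN, fourPi2, yPi2, yNu, yA, yT, yX4, cst, RExpr.eval] at *
  rw [hc, hπ]; push_cast; ring

/-- `PsiE` evaluates to `PsiN`. -/
theorem eval_PsiE : PsiE.eval y = PsiN (y 0) (y 2) (y 3) (y 10) (y 11) (y 12) := by
  have h1 := eval_tauNE y hπ
  obtain ⟨h2, h3⟩ := eval_xiE_zeE y hπ
  have h4 := eval_lapE y hπ
  have he := eval_etaE y hπ
  simp only [PsiE, PsiN, kapN, crN, kapE, crE, cst, RExpr.eval] at *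
  rw [h1, h2, h3, h4, he]; push_cast; ring_nf

/-- `bulkE` evaluates to `bulkN`. -/
theorem eval_bulkE : bulkE.eval y = bulkN (y 0) (y 2) (y 3) (y 10) (y 11) (y 12) := by
  have h1 := eval_tauNE y hπ
  obtain ⟨h2, h3⟩ := eval_xiE_zeE y hπ
  have he := eval_etaE y hπ
  have hc := eval_csE y hπ
  have hf := eval_fnnE y hπ
  have hm := eval_MNE y hπ
  simp only [bulkE, bulkN, delN, delE, cst, RExpr.eval] at *
  rw [h1, h2, h3, he, hc, hf, hm]; push_cast; ring

/-- `ZwE` evaluates to `ZwN`. -/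
theorem eval_ZwE : ZwE.eval y = ZwN (y 0) (y 2) (y 3) := by
  have hc := eval_csE y hπ
  have hf := eval_fnnE y hπ
  simp only [ZwE, ZwN, CwE, CwN, cst, yA, RExpr.eval] at *
  rw [hc, hf]; push_cast; ring

/-- `NhiE` evaluates to `NhiN` with `zw = ZwN`. -/
theorem eval_NhiE : NhiE.eval y = NhiN (y 0) (y 2) (y 3) (y 10) (y 11) (y 12) (ZwN (y 0) (y 2) (y 3)) := by
  have h1 := eval_PsiE y hπ
  have h2 := eval_bulkE y hπ
  have h3 := eval_ZwE y hπ
  have hm := eval_MNE y hπ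
  simp only [NhiE, NhiN, cst, RExpr.eval] at *
  rw [h1, h2, h3, hm]; push_cast; ring

omit hπ in
/-- `tauE` evaluates to `3ν − (3/2)Q̂₁/P̂`. -/
theorem eval_tauE : tauE.eval y = 3 * y 2 - 3 / 2 * y 8 * (y 6)⁻¹ := by
  simp only [tauE, yNu, yQ, yP, cst, RExpr.eval]; push_cast; ring

/-- ★ `rowCE` evaluates to `9(√ChiN + √NhiN)² − 48π⁴·bC·(π²ν)·(2ê₁ − τ)·τ`. -/
theorem eval_rowCE (xshi bC : ℚ) :
    (rowCE xshi bC).eval y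
      = 9 * (Real.sqrt (ChiN (y 0) (y 2) (y 3) (y 4) (y 10) xshi)
          + Real.sqrt (NhiN (y 0) (y 2) (y 3) (y 10) (y 11) (y 12) (ZwN (y 0) (y 2) (y 3)))) ^ 2
        - 48 * (Real.pi ^ 2) ^ 2 * bC * (Real.pi ^ 2 * y 2) * (2 * y 4 - (3 * y 2 - 3 / 2 * y 8 * (y 6)⁻¹))
          * (3 * y 2 - 3 / 2 * y 8 * (y 6)⁻¹) := by
  have h1 := eval_ChiE y hπ xshi
  have h2 := eval_NhiE y hπ
  have h3 := eval_tauE y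
  have he := eval_etaE y hπ
  simp only [rowCE, cst, yPi2, yE1, RExpr.eval] at *
  rw [h1, h2, h3, he, hπ]; unfold etaN; push_cast; ring

end eval

end RowC

end Summit.HubbardSuperconductivity.HubbardSuperconductivity.Theorems.AnisotropyChord.Transfer.Fibre3
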